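import Mathlib
import Summits.PneNP.PneNP.Theorems.SymmetryBudgetHamCompilesStubRref
import Summits.PneNP.PneNP.Theorems.SymmetryBudgetHamCompilesFDagSem

/-!
# The F-side gate DAG of the line `kotzig-cutspan`: the insertion block gate equations
# (stub `stub_symmetricF`, obligation 2/5 `stub_symmetricF_blocks`; crux
# `SymmetryBudget.HamCompiles`, stmt-PneNP-10637)

Every gate of every INSERTION BLOCK `(χ, k)` of the F-side DAG
(`SymmetryBudgetHamCompilesFDag.lean`: gate kinds `BK`, gate functions `bfn`, wiring `bargs`)
computes its intended bit (`bsem`, `SymmetryBudgetHamCompilesFDagSem.lean`) from the values of its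
wires, granted the wire values `WireVals` (obligation 1/5). Writing `y := yvec χ k` (the
inserted vector), `T := tabSem χ k` (the table `rrefRow (CH χ k)` it is inserted into),
`z := zfin χ k = reduceBy T y` (the remainder) and `zs s` for the sequential partial remainders:

* the `XOR₂` chain: `zs (s+1) = zs s + y (kc s) • T (kc s)` (`zs_succ`) and `zs N = z` (`zs_N`,
  reindexing by the coordinate enumeration `kc`);
* the lead locator `ld c = [z ≠ 0 ∧ lead z = c]` is the conjunction "`z c = 1` and `z` vanishes at
  every `skey`-smaller coordinate" (`lead_eq`, `lead_spec`);
* the new row bit `out c c'` is the Boolean form of `insertRow` (`rrefRow_sup_span`, clause 2 of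
  `stub_rref`, and `CH χ (k+1) = CH χ k ⊔ span {y}`).

Main result: `stub_symmetricF_blocks : WireVals m x → BlockEqs m x`.
-/

-- `Summit.PneNP.PneNP.…` duplicates `PneNP` BY DESIGN (single-problem summit, D-0017).
set_option linter.dupNamespace false

noncomputable section

namespace Summit.PneNP.PneNP.Theorems.HamCompilesKC

open Literature.Computability.Complexity
open Finset

namespace SymF

namespace Blk

variable {m : ℕ}

/-! ### Bits of `ZMod 2` scalars and small Boolean identities -/

/-- `tb` of a product is the conjunction. -/
theorem tb_mul (a b : ZMod 2) : tb (a * b) = (tb a && tb b) := by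
  revert a b; decide

/-- `tb` of a sum is the exclusive or. -/
theorem tb_add (a b : ZMod 2) : tb (a + b) = xor (tb a) (tb b) := by
  revert a b; decide

/-- `tb 0 = false`. -/
@[simp] theorem tb_zero : tb 0 = false := by decide

/-- `tb a` holds iff `a = 1`. -/
theorem tb_eq_true_iff {a : ZMod 2} : tb a = true ↔ a = 1 := by
  revert a; decide

/-- `tb a` fails iff `a = 0`. -/
theorem tb_eq_false_iff {a : ZMod 2} : tb a = false ↔ a = 0 := by
  revert a; decide

/-- The two-gate exclusive or: `(a ∨ b) ∧ ¬(a ∧ b) = a ⊕ b`. -/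
theorem or_and_not_and (a b : Bool) : ((a || b) && !(a && b)) = xor a b := by
  revert a b; decide

/-- Value of a binary `∧` gate. -/
theorem and2_apply (v : Fin 2 → Bool) : (GateFn.and 2).2 v = (v 0 && v 1) := by
  simp only [GateFn.and, Fin.forall_fin_two, Bool.decide_and, Bool.decide_eq_true]

/-- Value of a binary `∨` gate. -/
theorem or2_apply (v : Fin 2 → Bool) : (GateFn.or 2).2 v = (v 0 || v 1) := by
  simp only [GateFn.or, Fin.exists_fin_two, Bool.decide_or, Bool.decide_eq_true]

/-- Value of a `¬` gate. -/
theorem not_apply (v : Fin 1 → Bool) : GateFn.not.2 v = !(v 0) := rfl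

/-! ### The coordinate enumeration `kc` -/

/-- `kc` is onto. -/
theorem kc_surj (c : K m) : ∃ s : Fin (N m), kc s = c :=
  ⟨boolVecEquiv (gOf m) c, (boolVecEquiv (gOf m)).symm_apply_apply c⟩

/-- Reindexing a sum over coordinates by `kc`. -/
theorem sum_kc {M : Type*} [AddCommMonoid M] (f : K m → M) :
    ∑ s : Fin (N m), f (kc s) = ∑ c, f c :=
  Equiv.sum_comp (boolVecEquiv (gOf m)).symm f

/-! ### Wire values -/

section Wires

variable {x : Fin m × Fin m → Bool} {χ : ChCtx m} {k : Fin (N m)}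

/-- A block gate wire carries `bsem`. -/
theorem w_blk (κ : BK m) : wsem m x (fW (.blk χ k κ)) = bsem m x χ k κ := rfl

/-- Table wires (clause 5 of `WireVals`). -/
theorem w_tab (hW : WireVals m x) (c c' : K m) :
    wsem m x (tabW χ k c c') = tb (tabSem m x χ k c c') := by
  obtain ⟨-, -, -, -, hT, -, -, -, -⟩ := hW
  exact hT χ k c c'

/-- Row wires (clause 6 of `WireVals`). -/
theorem w_row (hW : WireVals m x) (c' : K m) :
    wsem m x (rowW χ k c') = tb (yvec m x χ k c') := by
  obtain ⟨-, -, -, -, -, hY, -, -, -⟩ := hW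
  exact hY χ k c'

/-- Remainder wires (clause 7 of `WireVals`). -/
theorem w_zW (hW : WireVals m x) {s : ℕ} (hs : s ≤ N m) (c' : K m) :
    wsem m x (zW χ k s c') = tb (zs m x χ k s c') := by
  obtain ⟨-, -, -, -, -, -, hZ, -, -⟩ := hW
  exact hZ χ k s c' hs

end Wires

/-! ### The sequential remainder -/

section Remainder

variable (x : Fin m × Fin m → Bool) (χ : ChCtx m) (k : Fin (N m))

/-- One step of the `XOR₂` chain: `zs (s+1) = zs s + y (kc s) • T (kc s)`. -/
theorem zs_succ (s : Fin (N m)) :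
    zs m x χ k ((s : ℕ) + 1) = zs m x χ k s + yvec m x χ k (kc s) • tabSem m x χ k (kc s) := by
  have h : ∀ s' : Fin (N m),
      (if (s' : ℕ) < (s : ℕ) + 1 then yvec m x χ k (kc s') • tabSem m x χ k (kc s') else 0) =
        (if (s' : ℕ) < (s : ℕ) then yvec m x χ k (kc s') • tabSem m x χ k (kc s') else 0) +
          (if s' = s then yvec m x χ k (kc s') • tabSem m x χ k (kc s') else 0) := by
    intro s'
    by_cases h1 : (s' : ℕ) < (s : ℕ)
    · have h2 : s' ≠ s := fun h => by rw [h] at h1; exact lt_irrefl _ h1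
      rw [if_pos (Nat.lt_succ_of_lt h1), if_pos h1, if_neg h2, add_zero]
    · by_cases h2 : s' = s
      · subst h2
        rw [if_pos (Nat.lt_succ_self _), if_neg h1, if_pos rfl, zero_add]
      · have h3 : ¬ (s' : ℕ) < (s : ℕ) + 1 := fun h =>
          h2 (Fin.ext (by have := Fin.val_ne_of_ne h2; omega))
        rw [if_neg h3, if_neg h1, if_neg h2, add_zero]
  unfold zs
  rw [Finset.sum_congr rfl fun s' _ => h s', Finset.sum_add_distrib, Finset.sum_ite_eq',
    if_pos (Finset.mem_univ _), add_assoc]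

/-- The last partial remainder is the full remainder: `zs N = reduceBy T y`. -/
theorem zs_N : zs m x χ k (N m) = zfin m x χ k := by
  unfold zs zfin reduceBy
  congr 1
  calc ∑ s' : Fin (N m), (if (s' : ℕ) < N m then
          yvec m x χ k (kc s') • tabSem m x χ k (kc s') else 0)
        = ∑ s' : Fin (N m), yvec m x χ k (kc s') • tabSem m x χ k (kc s') :=
          Finset.sum_congr rfl fun s' _ => if_pos s'.2
    _ = ∑ c, yvec m x χ k c • tabSem m x χ k c :=
          sum_kc (fun c => yvec m x χ k c • tabSem m x χ k c)

variable {x χ k} in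
/-- The final remainder wire carries `zfin`. -/
theorem w_zfW (hW : WireVals m x) (c' : K m) :
    wsem m x (zfW χ k c') = tb (zfin m x χ k c') := by
  rw [← zs_N]
  exact w_zW hW le_rfl c'

/-- The subspace after `k + 1` insertions. -/
theorem CH_succ :
    CH m x χ ((k : ℕ) + 1) = CH m x χ k ⊔ Submodule.span (ZMod 2) {yvec m x χ k} := by
  have hset : {v | ∃ k' : Fin (N m), (k' : ℕ) < (k : ℕ) + 1 ∧ v = yvec m x χ k'} =
      insert (yvec m x χ k) {v | ∃ k' : Fin (N m), (k' : ℕ) < (k : ℕ) ∧ v = yvec m x χ k'} := by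
    ext v
    simp only [Set.mem_setOf_eq, Set.mem_insert_iff]
    constructor
    · rintro ⟨k', hk', rfl⟩
      rcases Nat.lt_succ_iff_lt_or_eq.1 hk' with h | h
      · exact Or.inr ⟨k', h, rfl⟩
      · exact Or.inl (by rw [Fin.ext h])
    · rintro (rfl | ⟨k', hk', rfl⟩)
      · exact ⟨k, Nat.lt_succ_self _, rfl⟩
      · exact ⟨k', Nat.lt_succ_of_lt hk', rfl⟩
  unfold CH
  rw [hset, Submodule.span_insert, sup_left_comm]
  exact sup_comm _ _

end Remainder

/-- Entries of `insertRow R v`. -/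
theorem insertRow_apply_apply {g : ℕ} (R : (Fin g → Bool) → Vec g) (v : Vec g)
    (c c' : Fin g → Bool) :
    insertRow R v c c' =
      if reduceBy R v = 0 then R c c'
      else if c = lead (reduceBy R v) then reduceBy R v c'
      else R c c' + R c (lead (reduceBy R v)) * reduceBy R v c' := by
  unfold insertRow
  by_cases h : reduceBy R v = 0
  · rw [if_pos h, if_pos h]
  · rw [if_neg h, if_neg h]
    by_cases hc : c = lead (reduceBy R v)
    · rw [if_pos hc, if_pos hc]
    · rw [if_neg hc, if_neg hc]
      rfl

/-! ### The four non-definitional gate kinds -/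

section Gates

variable {x : Fin m × Fin m → Bool} {χ : ChCtx m} {k : Fin (N m)}

/-- `xr`: `zs (s+1) c' = xo ∧ xn` (one `XOR₂` of the chain). -/
theorem eq_xr (s : Fin (N m)) (c' : K m) :
    fsem m x (Sum.inr (FG.blk χ k (.xr s c'))) =
      (bfn m (.xr s c')).2 fun a => wsem m x (bargs χ k (.xr s c') a) := by
  simp only [fsem, gsem, bsem, bfn, bargs, and2_apply, Matrix.cons_val_zero, Matrix.cons_val_one,
    w_blk]
  rw [zs_succ, Pi.add_apply, Pi.smul_apply, smul_eq_mul, tb_add, or_and_not_and]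

/-- `ld`: `[z ≠ 0 ∧ lead z = c] = z c ∧ ⋀_{skey (kc s) < skey c} ¬ z (kc s)` (`lead_spec`,
`lead_eq`; `kc` is onto). -/
theorem eq_ld (hW : WireVals m x) (c : K m) :
    fsem m x (Sum.inr (FG.blk χ k (.ld c))) =
      (bfn m (.ld c)).2 fun a => wsem m x (bargs χ k (.ld c) a) := by
  simp only [fsem, gsem, bsem, bfn, bargs, GateFn.and]
  rw [Bool.eq_iff_iff]
  simp only [decide_eq_true_eq, Fin.forall_fin_succ, Fin.cases_zero, Fin.cases_succ, w_zfW hW]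
  constructor
  · rintro ⟨hz, hl⟩
    obtain ⟨h1, h2⟩ := lead_spec hz
    rw [hl] at h1 h2
    refine ⟨tb_eq_true_iff.2 ((zmod2_ne_zero_iff _).1 h1), fun s => ?_⟩
    by_cases hs : skey (kc s) < skey c
    · rw [if_pos hs, w_blk]
      simp only [bsem, h2 _ hs, tb_zero, Bool.not_false]
    · rw [if_neg hs]
      rfl
  · rintro ⟨h1, h2⟩
    have hc : zfin m x χ k c ≠ 0 := by
      rw [tb_eq_true_iff.1 h1]
      exact one_ne_zero
    have hlt : ∀ c', skey c' < skey c → zfin m x χ k c' = 0 := by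
      intro c' hc'
      obtain ⟨s, rfl⟩ := kc_surj c'
      have h := h2 s
      rw [if_pos hc', w_blk] at h
      simp only [bsem, Bool.not_eq_true', tb_eq_false_iff] at h
      exact h
    exact ⟨fun h => hc (by rw [h]; rfl), lead_eq hc hlt⟩

/-- `q`: `[z ≠ 0] ∧ T c (lead z) = ⋁_s al c (kc s)` (`kc` is onto). -/
theorem eq_q (c : K m) :
    fsem m x (Sum.inr (FG.blk χ k (.q c))) =
      (bfn m (.q c)).2 fun a => wsem m x (bargs χ k (.q c) a) := by
  simp only [fsem, gsem, bsem, bfn, bargs, GateFn.or]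
  rw [Bool.eq_iff_iff]
  simp only [Bool.and_eq_true, decide_eq_true_eq, w_blk, bsem]
  constructor
  · rintro ⟨hz, ht⟩
    obtain ⟨s, hs⟩ := kc_surj (lead (zfin m x χ k))
    exact ⟨s, ⟨hz, hs.symm⟩, by rwa [hs]⟩
  · rintro ⟨s, ⟨hz, hs⟩, ht⟩
    exact ⟨hz, by rwa [hs]⟩

/-- `out`: THE INSERTION LEMMA — bit `(c, c')` of `rrefRow (CH χ (k+1)) = insertRow T y`
(`CH_succ`, `rrefRow_sup_span`) is `(ld c ∧ z c') ∨ (¬ ld c ∧ (T c c' ⊕ (z c' ∧ q c)))`: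
the three cases `z = 0` / `c = lead z` / `c ≠ lead z` of `insertRow`. -/
theorem eq_out (c c' : K m) :
    fsem m x (Sum.inr (FG.blk χ k (.out c c'))) =
      (bfn m (.out c c')).2 fun a => wsem m x (bargs χ k (.out c c') a) := by
  simp only [fsem, gsem, bsem, bfn, bargs, or2_apply, Matrix.cons_val_zero, Matrix.cons_val_one,
    w_blk]
  rw [CH_succ, rrefRow_sup_span]
  show tb (insertRow (tabSem m x χ k) (yvec m x χ k) c c') = _
  rw [insertRow_apply_apply,
    show reduceBy (tabSem m x χ k) (yvec m x χ k) = zfin m x χ k from rfl]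
  by_cases hz : zfin m x χ k = 0
  · simp [hz]
  · rw [if_neg hz]
    by_cases hc : c = lead (zfin m x χ k)
    · rw [if_pos hc]
      have hl : lead (zfin m x χ k) = c := hc.symm
      simp [hz, hl]
    · rw [if_neg hc]
      have hl : lead (zfin m x χ k) ≠ c := fun h => hc h.symm
      simp [hz, hl, tb_add, tb_mul, Bool.and_comm]

end Gates

end Blk

end SymF

/-- **Obligation `stub_symmetricF_blocks` of stub `stub_symmetricF`** (line `kotzig-cutspan`):
granted the wire values, every gate of every insertion block of the F-side DAG computes its
intended bit from its wires. The kinds `xr`, `ld`, `q`, `out` are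
`SymF.Blk.eq_xr/eq_ld/eq_q/eq_out`; the other fourteen kinds hold by unfolding the semantics of
their (block, table, row, remainder) wires. -/
theorem stub_symmetricF_blocks (m : ℕ) (x : Fin m × Fin m → Bool) :
    SymF.WireVals m x → SymF.BlockEqs m x := by
  intro hW χ k κ
  have hz : ∀ (s : Fin (SymF.N m)) (c' : SymF.K m),
      SymF.wsem m x (SymF.zW χ k s c') = SymF.tb (SymF.zs m x χ k s c') :=
    fun s c' => SymF.Blk.w_zW hW (le_of_lt s.2) c'
  cases κ with
  | xr s c' => exact SymF.Blk.eq_xr s c'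
  | ld c => exact SymF.Blk.eq_ld hW c
  | q c => exact SymF.Blk.eq_q c
  | out c c' => exact SymF.Blk.eq_out c c'
  | _ =>
    simp only [SymF.fsem, SymF.gsem, SymF.bsem, SymF.bfn, SymF.bargs, SymF.Blk.and2_apply,
      SymF.Blk.or2_apply, SymF.Blk.not_apply, Matrix.cons_val_zero, Matrix.cons_val_one,
      SymF.Blk.w_blk, SymF.Blk.w_row hW, SymF.Blk.w_tab hW, SymF.Blk.w_zfW hW, hz,
      SymF.Blk.tb_mul, SymF.Blk.or_and_not_and]

end Summit.PneNP.PneNP.Theorems.HamCompilesKC
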